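import Mathlib
import Summits.Ventures.HodgeRepro.HodgeSets
import Summits.Ventures.HodgeRepro.CMHodgeGalois

/-!
# Hodge structures of CM type: exterior powers, the type of a coordinate wedge, and Pohlmann's condition

Blind re-derivation cell `pub-hodge-repro`, seat `typer-2`.  Built on `CMHodge.lean` (`cochar`, the
cocharacter `μ_Φ(λ)` of a set of embeddings `Φ`), `CMHodgeGalois.lean` (`smulSet`, `toGalSet`: the Galois
conjugates `sΦ` and the group model) and typer's `HodgeSets.lean` (`IsHodgeSet` = Pohlmann's (9.2.1)).

Printed source (Deligne, LNM 900, Example 3.7, scan p. 41, continued): `H₁(A) ⊗ ℂ = E ⊗ ℂ ≅ ℂ^S`, the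
cocharacter `μ_Φ(λ)` acts as `λ` on `ℂ^Φ` and as `1` on `ℂ^{Φ̄}`; the Mumford–Tate group of `A` is the
subtorus of `Res_{E/ℚ} 𝔾_m` whose cocharacter module is `ℤ[G]·μ_Φ`, i.e. the torus generated by the Galois
conjugates `μ_{sΦ}`, `s ∈ G`.  A class of `⋀^{2p} H¹(A, ℚ)` is a Hodge class iff it is of type `(p, p)`,
iff it is fixed by the Mumford–Tate group (Deligne §3), iff — on the basis of coordinate wedges — every
conjugate cocharacter `μ_{sΦ}(λ)` multiplies it by `λ^p`.  Pohlmann's census (Gordon §9.2, (9.2.1))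
makes this explicit: the coordinate wedge `e_Δ = ⋀_{σ ∈ Δ} e_σ`, `|Δ| = 2p`, is a Hodge class iff
`|Δ ∩ sΦ| = p` for every `s ∈ G`.

This file types the combinatorial heart of that statement on Mathlib's exterior powers
(`exteriorPower.map`, `exteriorPower.ιMulti`):

* `coordWedge n s = e_{s 0} ∧ ⋯ ∧ e_{s (n−1)} ∈ ⋀[ℂ]^n ℂ^{Hom(K, ℂ)}` for `s : Fin n → Hom(K, ℂ)`;
* **`map_cochar_coordWedge`**: `⋀^n μ_Φ(λ)` multiplies `coordWedge n s` by `λ^{|{i : s i ∈ Φ}|}`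
  (`cornerCount Φ s`; `= |S ∩ Φ|` for the set `S` of corners when `s` is injective);
* `coordWedge_ne_zero` (injective `s`; via the pairing with the coordinate projections) and the
  uniqueness of the exponent, whence **`forall_map_cochar_coordWedge_eq_iff`**: `e_S` is of type
  `(p, n − p)` for `μ_Φ` iff `|S ∩ Φ| = p`;
* Galois case (`K/ℚ` Galois, base point `φ₀`): **`forall_map_cochar_smulSet_eq_iff`** — `e_S` is of
  type `(p, p)` for EVERY conjugate cocharacter `μ_{sΦ}` iff `|S ∩ sΦ| = p` for all `s`, i.e. iff the
  group-model sets satisfy Pohlmann's condition (**`isHodgeSet_iff_forall_map_cochar_smulSet_eq`**,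
  through typer's `isHodgeSet_iff_forall_card_eq`).

What is NOT typed here (Deligne §3, printed): that the Hodge classes of `A` are exactly the classes fixed by
the Mumford–Tate group and that `MT(A)` is generated by the conjugate cocharacters.  The file only computes
the action of those cocharacters on the coordinate wedges.
-/

open Module Finset
open scoped Pointwise

namespace HodgeRepro.CMHodge

variable {K : Type*} [Field K] [NumberField K]

section Wedge

variable [DecidableEq (K →ₐ[ℚ] ℂ)]

/-- The coordinate vector `e_σ ∈ ℂ^{Hom(K, ℂ)}`. -/
def coordVec (σ : K →ₐ[ℚ] ℂ) : (K →ₐ[ℚ] ℂ) → ℂ := Pi.single σ 1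

/-- `e_σ τ = 1` if `τ = σ`, `0` otherwise. -/
theorem coordVec_apply (σ τ : K →ₐ[ℚ] ℂ) : coordVec σ τ = if τ = σ then 1 else 0 := by
  simp [coordVec, Pi.single_apply]

/-- `e_σ ≠ 0`. -/
theorem coordVec_ne_zero (σ : K →ₐ[ℚ] ℂ) : coordVec σ ≠ 0 := by
  intro h
  have := congr_fun h σ
  simp [coordVec_apply] at this

/-- `e_σ ∈ ℂ^Φ` for `σ ∈ Φ`. -/
theorem coordVec_mem_weightSpace {Φ : Set (K →ₐ[ℚ] ℂ)} {σ : K →ₐ[ℚ] ℂ} (h : σ ∈ Φ) :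
    coordVec σ ∈ weightSpace Φ := by
  intro τ hτ
  rw [coordVec_apply, if_neg]
  rintro rfl
  exact hτ h

/-- `e_σ ∈ ℂ^{Φᶜ}` for `σ ∉ Φ`. -/
theorem coordVec_mem_weightSpace_compl {Φ : Set (K →ₐ[ℚ] ℂ)} {σ : K →ₐ[ℚ] ℂ} (h : σ ∉ Φ) :
    coordVec σ ∈ weightSpace Φᶜ :=
  coordVec_mem_weightSpace (Φ := Φᶜ) h

/-- The cocharacter acts on a coordinate vector by `λ` or `1` according to whether `σ ∈ Φ`. -/
theorem cochar_coordVec (Φ : Set (K →ₐ[ℚ] ℂ)) [DecidablePred (· ∈ Φ)] (lam : ℂ) (σ : K →ₐ[ℚ] ℂ) :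
    cochar Φ lam (coordVec σ) = (if σ ∈ Φ then lam else 1) • coordVec σ := by
  by_cases h : σ ∈ Φ
  · rw [if_pos h, cochar_apply_of_mem_weightSpace Φ lam (coordVec_mem_weightSpace h)]
  · rw [if_neg h, cochar_apply_of_mem_weightSpace_compl Φ lam (coordVec_mem_weightSpace_compl h),
      one_smul]

/-- The coordinate wedge `e_{s 0} ∧ ⋯ ∧ e_{s (n−1)} ∈ ⋀[ℂ]^n ℂ^{Hom(K, ℂ)}` of a family of embeddings
`s : Fin n → Hom(K, ℂ)` (the basis vector `⟨Δ⟩` of Pohlmann's census when `s` enumerates `Δ`). -/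
noncomputable def coordWedge (n : ℕ) (s : Fin n → (K →ₐ[ℚ] ℂ)) : ⋀[ℂ]^n ((K →ₐ[ℚ] ℂ) → ℂ) :=
  exteriorPower.ιMulti ℂ n fun i => coordVec (s i)

/-- The number of corners of `s` lying in `Φ`: `|{i : s i ∈ Φ}|`. -/
def cornerCount (Φ : Set (K →ₐ[ℚ] ℂ)) [DecidablePred (· ∈ Φ)] {n : ℕ} (s : Fin n → (K →ₐ[ℚ] ℂ)) : ℕ :=
  (univ.filter fun i => s i ∈ Φ).card

/-- For an injective enumeration `s` of the set `S = range s`, `cornerCount Φ s = |S ∩ Φ|`. -/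
theorem cornerCount_eq_card_filter_image (Φ : Set (K →ₐ[ℚ] ℂ)) [DecidablePred (· ∈ Φ)] {n : ℕ}
    {s : Fin n → (K →ₐ[ℚ] ℂ)} (hs : Function.Injective s) :
    cornerCount Φ s = ((univ.image s).filter (· ∈ Φ)).card := by
  unfold cornerCount
  rw [Finset.filter_image, Finset.card_image_of_injective _ hs]

/-- **The weight of a coordinate wedge**: `⋀^n μ_Φ(λ)` multiplies `e_{s 0} ∧ ⋯ ∧ e_{s (n−1)}` by
`λ^{|{i : s i ∈ Φ}|}` — the Hodge type of `⟨Δ⟩` is `(|Δ ∩ Φ|, |Δ ∖ Φ|)` (typer's `hodgeP` / `hodgeQ`). -/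
theorem map_cochar_coordWedge (Φ : Set (K →ₐ[ℚ] ℂ)) [DecidablePred (· ∈ Φ)] (lam : ℂ) {n : ℕ}
    (s : Fin n → (K →ₐ[ℚ] ℂ)) :
    exteriorPower.map n (cochar Φ lam) (coordWedge n s) = lam ^ cornerCount Φ s • coordWedge n s := by
  unfold coordWedge cornerCount
  rw [exteriorPower.map_apply_ιMulti]
  have h : (cochar Φ lam ∘ fun i => coordVec (s i)) =
      fun i => (if s i ∈ Φ then lam else 1) • coordVec (s i) := by
    funext i
    exact cochar_coordVec Φ lam (s i)
  have h2 := AlternatingMap.map_smul_univ (exteriorPower.ιMulti ℂ n)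
    (fun i => if s i ∈ Φ then lam else 1) (fun i => coordVec (s i))
  rw [h, h2, Finset.prod_ite, Finset.prod_const_one, mul_one, Finset.prod_const]

/-- The pairing of the wedge of the coordinate projections `pr_{s j}` with the coordinate wedge of an
injective `s` is `1` (the matrix `(pr_{s j} e_{s i})_{i j}` is the identity). -/
theorem pairingDual_proj_coordWedge {n : ℕ} {s : Fin n → (K →ₐ[ℚ] ℂ)} (hs : Function.Injective s) :
    exteriorPower.pairingDual ℂ ((K →ₐ[ℚ] ℂ) → ℂ) n
      (exteriorPower.ιMulti ℂ n fun j => (LinearMap.proj (s j) : ((K →ₐ[ℚ] ℂ) → ℂ) →ₗ[ℂ] ℂ))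
      (coordWedge n s) = 1 := by
  unfold coordWedge
  rw [exteriorPower.pairingDual_ιMulti_ιMulti]
  have h : (Matrix.of fun i j : Fin n =>
      (LinearMap.proj (s j) : ((K →ₐ[ℚ] ℂ) → ℂ) →ₗ[ℂ] ℂ) (coordVec (s i))) = (1 : Matrix (Fin n) (Fin n) ℂ) := by
    ext i j
    rw [Matrix.of_apply, LinearMap.proj_apply, coordVec_apply, Matrix.one_apply]
    by_cases hij : i = j
    · subst hij
      simp
    · rw [if_neg (fun h => hij (hs h).symm), if_neg hij]
  rw [h, Matrix.det_one]

/-- The coordinate wedge of an injective family of embeddings is non-zero. -/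
theorem coordWedge_ne_zero {n : ℕ} {s : Fin n → (K →ₐ[ℚ] ℂ)} (hs : Function.Injective s) :
    coordWedge n s ≠ 0 := by
  intro h
  have := pairingDual_proj_coordWedge hs
  rw [h, map_zero] at this
  exact zero_ne_one this

omit [DecidableEq (K →ₐ[ℚ] ℂ)] in
/-- If every `⋀^n μ_Φ(λ)` multiplies a non-zero `ω` both by `λ^p` and by `λ^q`, then `p = q`
(evaluate at `λ = 2`). -/
theorem exponent_unique (Φ : Set (K →ₐ[ℚ] ℂ)) [DecidablePred (· ∈ Φ)] {n : ℕ}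
    {ω : ⋀[ℂ]^n ((K →ₐ[ℚ] ℂ) → ℂ)} (hω : ω ≠ 0) {p q : ℕ}
    (hp : ∀ lam : ℂ, exteriorPower.map n (cochar Φ lam) ω = lam ^ p • ω)
    (hq : ∀ lam : ℂ, exteriorPower.map n (cochar Φ lam) ω = lam ^ q • ω) : p = q := by
  have h := (hp 2).symm.trans (hq 2)
  have h0 : (2 : ℂ) ^ p = 2 ^ q := smul_left_injective ℂ hω h
  have h' : ((2 ^ p : ℕ) : ℂ) = ((2 ^ q : ℕ) : ℂ) := by push_cast; exact h0
  exact Nat.pow_right_injective (le_refl 2) (Nat.cast_injective h')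

/-- **Type of a coordinate wedge**: for an injective `s`, `e_{s 0} ∧ ⋯ ∧ e_{s (n−1)}` is of type
`(p, n − p)` for `μ_Φ` (every `⋀^n μ_Φ(λ)` multiplies it by `λ^p`) iff exactly `p` of its corners lie
in `Φ`. -/
theorem forall_map_cochar_coordWedge_eq_iff (Φ : Set (K →ₐ[ℚ] ℂ)) [DecidablePred (· ∈ Φ)] {n : ℕ}
    {s : Fin n → (K →ₐ[ℚ] ℂ)} (hs : Function.Injective s) (p : ℕ) :
    (∀ lam : ℂ, exteriorPower.map n (cochar Φ lam) (coordWedge n s) = lam ^ p • coordWedge n s) ↔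
      cornerCount Φ s = p := by
  constructor
  · intro h
    exact exponent_unique Φ (coordWedge_ne_zero hs) (fun lam => map_cochar_coordWedge Φ lam s) h
  · rintro rfl lam
    exact map_cochar_coordWedge Φ lam s

end Wedge

section Galois

open scoped Classical

/-- Membership in the translate of the finset of a set of group elements. -/
theorem mem_smul_toFinset_iff (g x : K ≃ₐ[ℚ] K) (S : Set (K ≃ₐ[ℚ] K)) :
    x ∈ g • S.toFinset ↔ x ∈ g • S := by
  rw [← Finset.mem_coe, Finset.coe_smul_finset, Set.coe_toFinset]

variable [IsGalois ℚ K] (φ₀ : K →+* ℂ)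

/-- The corners of `s` in the conjugate `sΦ`, counted in the group model: `|{i : s i ∈ gΦ}|` equals
`|Δ' ∩ g • Φ'|` for `Δ' = toGalSet φ₀ (range s)` and `Φ' = toGalSet φ₀ Φ`, as finsets of `Gal(K/ℚ)`. -/
theorem cornerCount_smulSet_eq_card (Φ : Set (K →ₐ[ℚ] ℂ)) (g : K ≃ₐ[ℚ] K) {n : ℕ}
    {s : Fin n → (K →ₐ[ℚ] ℂ)} (hs : Function.Injective s) :
    cornerCount (smulSet φ₀ g Φ) s =
      ((toGalSet φ₀ (Set.range s)).toFinset ∩ g • (toGalSet φ₀ Φ).toFinset).card := by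
  rw [cornerCount_eq_card_filter_image _ hs]
  -- both sides count the same set through the bijection `galEquivAlgHom K φ₀`
  have key : (toGalSet φ₀ (Set.range s)).toFinset ∩ g • (toGalSet φ₀ Φ).toFinset =
      ((univ.image s).filter (· ∈ smulSet φ₀ g Φ)).map (galEquivAlgHom K φ₀).symm.toEmbedding := by
    ext x
    simp only [Finset.mem_inter, Set.mem_toFinset, mem_toGalSet, Set.mem_range, Finset.mem_map,
      Finset.mem_filter, Finset.mem_image, Finset.mem_univ, true_and, Equiv.coe_toEmbedding,
      mem_smul_toFinset_iff]
    constructor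
    · rintro ⟨⟨i, hi⟩, hx⟩
      refine ⟨galEquivAlgHom K φ₀ x, ⟨⟨i, hi⟩, ?_⟩, (galEquivAlgHom K φ₀).symm_apply_apply x⟩
      rw [← mem_toGalSet, toGalSet_smulSet]
      exact hx
    · rintro ⟨y, ⟨⟨i, hi⟩, hy⟩, rfl⟩
      refine ⟨⟨i, by rwa [Equiv.apply_symm_apply]⟩, ?_⟩
      have : (galEquivAlgHom K φ₀).symm y ∈ toGalSet φ₀ (smulSet φ₀ g Φ) := by
        rw [mem_toGalSet, Equiv.apply_symm_apply]
        exact hy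
      rwa [toGalSet_smulSet] at this
  rw [key, Finset.card_map]

/-- **Hodge type for all conjugates ⟺ Pohlmann's condition (set form)**: for an injective `s` and
`p : ℕ`, the coordinate wedge `e_{s 0} ∧ ⋯ ∧ e_{s (n−1)}` is of type `(p, n − p)` for EVERY conjugate
cocharacter `μ_{gΦ}`, `g ∈ Gal(K/ℚ)`, iff `|Δ' ∩ g Φ'| = p` for every `g` in the group model. -/
theorem forall_map_cochar_smulSet_eq_iff (Φ : Set (K →ₐ[ℚ] ℂ)) {n : ℕ} {s : Fin n → (K →ₐ[ℚ] ℂ)}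
    (hs : Function.Injective s) (p : ℕ) :
    (∀ (g : K ≃ₐ[ℚ] K) (lam : ℂ), exteriorPower.map n (cochar (smulSet φ₀ g Φ) lam) (coordWedge n s) =
        lam ^ p • coordWedge n s) ↔
      ∀ g : K ≃ₐ[ℚ] K,
        ((toGalSet φ₀ (Set.range s)).toFinset ∩ g • (toGalSet φ₀ Φ).toFinset).card = p := by
  refine forall_congr' fun g => ?_
  rw [forall_map_cochar_coordWedge_eq_iff _ hs, cornerCount_smulSet_eq_card φ₀ Φ g hs]

/-- The group-model set of the corners of an injective `s : Fin n → Hom(K, ℂ)` has `n` elements. -/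
theorem card_toGalSet_range (n : ℕ) {s : Fin n → (K →ₐ[ℚ] ℂ)} (hs : Function.Injective s) :
    (toGalSet φ₀ (Set.range s)).toFinset.card = n := by
  have : (toGalSet φ₀ (Set.range s)).toFinset =
      (univ.image s).map (galEquivAlgHom K φ₀).symm.toEmbedding := by
    ext x
    simp only [Set.mem_toFinset, mem_toGalSet, Set.mem_range, Finset.mem_map, Finset.mem_image,
      Finset.mem_univ, true_and, Equiv.coe_toEmbedding]
    constructor
    · rintro ⟨i, hi⟩
      exact ⟨galEquivAlgHom K φ₀ x, ⟨i, hi⟩, (galEquivAlgHom K φ₀).symm_apply_apply x⟩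
    · rintro ⟨y, ⟨i, hi⟩, rfl⟩
      exact ⟨i, by rwa [Equiv.apply_symm_apply]⟩
  rw [this, Finset.card_map, Finset.card_image_of_injective _ hs, Finset.card_univ, Fintype.card_fin]

/-- **Pohlmann's condition = Hodge type `(p, p)` for all conjugate cocharacters**: on a Galois CM field
with complex conjugation `c` and a CM type `Φ` (group-model hypotheses `hc`, `hΦ`, e.g. from
`HeckeBridge.isComplexConj_conjGal` / `isCMType_of_isCMTypeEmb`), for an injective enumeration `s` of a
set `Δ` of `2p` embeddings: `IsHodgeSet c Φ' Δ'` (typer's (9.2.1) on the group-model sets) iff every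
`⋀^{2p} μ_{gΦ}(λ)` multiplies the coordinate wedge `e_Δ` by `λ^p`. -/
theorem isHodgeSet_iff_forall_map_cochar_smulSet_eq {c : K ≃ₐ[ℚ] K} (hc : IsComplexConj c)
    (Φ : Set (K →ₐ[ℚ] ℂ)) (hΦ : IsCMType c (toGalSet φ₀ Φ).toFinset) {p : ℕ}
    {s : Fin (2 * p) → (K →ₐ[ℚ] ℂ)} (hs : Function.Injective s) :
    IsHodgeSet c (toGalSet φ₀ Φ).toFinset (toGalSet φ₀ (Set.range s)).toFinset ↔
      ∀ (g : K ≃ₐ[ℚ] K) (lam : ℂ),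
        exteriorPower.map (2 * p) (cochar (smulSet φ₀ g Φ) lam) (coordWedge (2 * p) s) =
          lam ^ p • coordWedge (2 * p) s := by
  rw [isHodgeSet_iff_forall_card_eq hc hΦ _ p (card_toGalSet_range φ₀ (2 * p) hs),
    forall_map_cochar_smulSet_eq_iff φ₀ Φ hs p]

end Galois

end HodgeRepro.CMHodge
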